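import Mathlib

/-!
# Continuous unitary characters of subgroups of profinite abelian groups extend
(kernel witness for the standard fact (A8b) of the Tier-5 [A]-ledger, profinite case)

The [A]-ledger of the toric-period section records as a standard fact
«(A8b) characters of a closed subgroup of a compact abelian group extend to the group
(Pontryagin duality)».  Mathlib has no Pontryagin duality, but for a PROFINITE abelian group
(compact, totally disconnected — the case of the unit groups and norm-one groups of local fields,
which is where the fact is used) the statement has an elementary proof, kernel-checked here,
and the subgroup need not even be closed:

* `eq_one_of_forall_pow_re_pos` — the circle has **no small subgroups**: an element all of whose
  powers have positive real part is `1` (so a subgroup of the circle contained in the open right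
  half-plane is trivial);
* `exists_open_subgroup_le_ker` — for a topological abelian group `G` whose open subgroups form a
  neighbourhood basis of `1` (hypothesis `hbasis`), a continuous character `χ : H →* Circle` of an
  arbitrary subgroup `H ≤ G` (subspace topology) is trivial on `H ∩ U` for some open subgroup
  `U ≤ G`;
* `exists_continuous_extension_of_open_subgroup_le_ker` — a character of `H` trivial on `H ∩ U`,
  `U` an open subgroup, extends to a continuous character of `G` trivial on `U` (the algebraic
  extension is Baer's criterion applied to the divisible group `Circle`, along the injection
  `H/(H ∩ U) ↪ G/U`; continuity is automatic for a homomorphism trivial on an open subgroup);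
* `exists_continuous_extension_circle_of_profinite` — **(A8b), profinite form**: for `G` a compact
  totally disconnected abelian topological group and ANY subgroup `H ≤ G`, every continuous
  `χ : H →* Circle` extends to a continuous `χ' : G →* Circle`;
* `exists_continuous_extension_circle_of_basis` — the same under the weaker hypothesis `hbasis`.

Not modelled: local fields, Pontryagin duality, Haar measure; the reduction of the prose statement
(closed subgroup, compact group) to this one is the remark that the groups in play are profinite.
Mathlib-only; axioms standard.  Uses an L-value-free non-vanishing device: NO (README §8(d)).
-/

namespace Summit.Ventures.HodgeRepro2.T5ProfiniteCharacterExtension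

open Complex Real Topology

/-! ### 1. The circle has no small subgroups -/

/-- **No small subgroups.** If every power of `z : Circle` has positive real part, then `z = 1`.
Proof: write `θ = arg z ∈ (-π/2, π/2)`, `θ ≠ 0`; for `n = ⌈(π/2)/|θ|⌉₊` one has
`π/2 ≤ n|θ| < π`, so `arg (z ^ n) = nθ` and `|arg (z ^ n)| ≥ π/2`, i.e. `re (z ^ n) ≤ 0`. -/
theorem eq_one_of_forall_pow_re_pos (z : Circle)
    (h : ∀ n : ℕ, 0 < ((z ^ n : Circle) : ℂ).re) : z = 1 := by
  by_contra hz
  have hθ0 : arg (z : ℂ) ≠ 0 := fun h0 => hz (Circle.arg_eq_zero.mp h0)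
  have hθ : |arg (z : ℂ)| < π / 2 := by
    have h1 := h 1
    simp only [pow_one] at h1
    exact abs_arg_lt_pi_div_two_iff.mpr (Or.inl h1)
  set θ := arg (z : ℂ) with hθdef
  have habs : 0 < |θ| := abs_pos.mpr hθ0
  set n : ℕ := ⌈(π / 2) / |θ|⌉₊ with hn
  have hn1 : π / 2 ≤ n * |θ| := by
    have := Nat.le_ceil ((π / 2) / |θ|)
    rwa [div_le_iff₀ habs] at this
  have hn2 : n * |θ| < π := by
    have h1 := Nat.ceil_lt_add_one (by positivity : (0 : ℝ) ≤ (π / 2) / |θ|)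
    have h2 : (n : ℝ) * |θ| < ((π / 2) / |θ| + 1) * |θ| := mul_lt_mul_of_pos_right h1 habs
    rw [add_mul, div_mul_cancel₀ _ habs.ne', one_mul] at h2
    linarith
  have hn0 : n ≠ 0 := by
    intro h0
    rw [h0] at hn1
    simp only [Nat.cast_zero, zero_mul] at hn1
    linarith [Real.pi_pos]
  have hnpos : (0 : ℝ) < n := by exact_mod_cast Nat.pos_of_ne_zero hn0
  -- `arg (z ^ n) = n * θ` because `n * θ ∈ (-π, π]`
  have harg : arg ((z ^ n : Circle) : ℂ) = n * θ := by
    rw [Circle.coe_pow, ← arg_coe_angle_toReal_eq_arg, arg_pow_coe_angle,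
      (Real.Angle.nsmul_toReal_eq_mul hn0).mpr ?_, arg_coe_angle_toReal_eq_arg]
    rw [arg_coe_angle_toReal_eq_arg]
    constructor
    · rw [div_lt_iff₀' hnpos]
      have : -(n * |θ|) ≤ n * θ := by
        have := neg_abs_le θ
        nlinarith
      linarith
    · rw [le_div_iff₀' hnpos]
      have : n * θ ≤ n * |θ| := by
        have := le_abs_self θ
        nlinarith
      linarith
  have h2 := abs_arg_lt_pi_div_two_iff.mpr (Or.inl (h n))
  rw [harg, abs_mul, Nat.abs_cast] at h2
  linarith

/-- The subgroup form: a subgroup of the circle contained in the open right half-plane is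
trivial. -/
theorem subgroup_eq_bot_of_re_pos (S : Subgroup Circle)
    (hS : ∀ z ∈ S, 0 < ((z : Circle) : ℂ).re) : S = ⊥ := by
  refine (Subgroup.eq_bot_iff_forall S).mpr fun z hz => ?_
  exact eq_one_of_forall_pow_re_pos z fun n => hS _ (S.pow_mem hz n)

/-! ### 2. Roots and divisibility of the circle (for Baer's criterion) -/

/-- `n`-th roots on the circle: `root z n = exp (i · arg z / n)` for `n ≠ 0`. -/
noncomputable instance instRootableByNat : RootableBy Circle ℕ where
  root z n := if n = 0 then 1 else Circle.exp (arg (z : ℂ) / n)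
  root_zero _ := by simp
  root_cancel {n} z hn := by
    simp only [hn, if_false]
    rw [← Circle.exp_natCast_mul, mul_div_cancel₀ _ (Nat.cast_ne_zero.mpr hn)]
    exact Circle.exp_arg z

/-- Integer roots on the circle. -/
noncomputable instance instRootableByInt : RootableBy Circle ℤ :=
  Group.rootableByIntOfRootableByNat Circle

/-- The additive group of the circle is `ℤ`-divisible. -/
noncomputable instance instDivisibleByAdditive : DivisibleBy (Additive Circle) ℤ where
  div a n := Additive.ofMul (RootableBy.root (Additive.toMul a) n)
  div_zero _ := by simp [RootableBy.root_zero]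
  div_cancel {n} a hn := by
    rw [← ofMul_zpow, RootableBy.root_cancel _ hn]
    rfl

/-! ### 3. A continuous character is trivial on `H ∩ U` for an open subgroup `U` -/

variable {G : Type*} [CommGroup G] [TopologicalSpace G] [IsTopologicalGroup G]

omit [IsTopologicalGroup G] in
/-- If the open subgroups of `G` form a neighbourhood basis of `1` (hypothesis `hbasis`), then a
continuous character `χ : H →* Circle` of ANY subgroup `H ≤ G` (subspace topology) is trivial on
`H ∩ U` for some open subgroup `U ≤ G`.  Proof: `{h | re χ h > 0}` is open in `H`, hence of the
form `H ∩ W` with `W` open in `G`, `1 ∈ W`; take `U ⊆ W`; on `H ∩ U` every power of `χ h` has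
positive real part, so `χ h = 1` by `eq_one_of_forall_pow_re_pos`. -/
theorem exists_open_subgroup_le_ker
    (hbasis : ∀ W : Set G, IsOpen W → (1 : G) ∈ W →
      ∃ U : Subgroup G, IsOpen (U : Set G) ∧ (U : Set G) ⊆ W)
    (H : Subgroup G) (χ : H →* Circle) (hχ : Continuous χ) :
    ∃ U : Subgroup G, IsOpen (U : Set G) ∧ ∀ h : H, (h : G) ∈ U → χ h = 1 := by
  have hS : IsOpen {h : H | 0 < ((χ h : Circle) : ℂ).re} :=
    isOpen_lt continuous_const (Complex.continuous_re.comp (continuous_subtype_val.comp hχ))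
  obtain ⟨W, hW, hWS⟩ := isOpen_induced_iff.mp hS
  have h1W : (1 : G) ∈ W := by
    have : (1 : H) ∈ Subtype.val ⁻¹' W := by
      rw [hWS]
      simp
    simpa using this
  obtain ⟨U, hU, hUW⟩ := hbasis W hW h1W
  refine ⟨U, hU, fun h hh => ?_⟩
  apply eq_one_of_forall_pow_re_pos
  intro n
  have hmem : (h ^ n : H) ∈ Subtype.val ⁻¹' W := by
    show ((h ^ n : H) : G) ∈ W
    apply hUW
    simpa using U.pow_mem hh n
  rw [hWS] at hmem
  simpa [map_pow] using hmem

/-- Profinite groups satisfy the basis hypothesis of `exists_open_subgroup_le_ker`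
(Mathlib's `ProfiniteGrp.exist_openNormalSubgroup_sub_open_nhds_of_one`). -/
theorem basis_of_profinite [CompactSpace G] [TotallyDisconnectedSpace G] :
    ∀ W : Set G, IsOpen W → (1 : G) ∈ W →
      ∃ U : Subgroup G, IsOpen (U : Set G) ∧ (U : Set G) ⊆ W := by
  intro W hW h1
  obtain ⟨U, hU⟩ := ProfiniteGrp.exist_openNormalSubgroup_sub_open_nhds_of_one hW h1
  exact ⟨U.toSubgroup, U.isOpen, hU⟩

/-! ### 4. Extension along an open subgroup in the kernel -/

/-- A homomorphism into a topological monoid which is trivial on an open subgroup is continuous. -/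
theorem continuous_of_eq_one_on_open_subgroup {M : Type*} [MulOneClass M] [TopologicalSpace M]
    [ContinuousMul M] (φ : G →* M) (U : Subgroup G) (hU : IsOpen (U : Set G))
    (hφ : ∀ u ∈ U, φ u = 1) : Continuous φ := by
  refine continuous_of_continuousAt_one φ ?_
  have hev : φ =ᶠ[𝓝 (1 : G)] fun _ => (1 : M) := by
    filter_upwards [hU.mem_nhds U.one_mem] with u hu
    exact hφ u hu
  exact (continuousAt_const (y := (1 : M))).congr hev.symm

/-- A character `χ : H →* Circle` trivial on `H ∩ U`, where `U ≤ G` is an OPEN subgroup, extends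
to a continuous character `χ' : G →* Circle` trivial on `U`.  Proof: `χ` descends to
`H/(H ∩ U) ≅ HU/U ↪ G/U`; Baer's criterion for the divisible group `Circle` extends it to `G/U`;
the composite with `G → G/U` is trivial on the open subgroup `U`, hence continuous. -/
theorem exists_continuous_extension_of_open_subgroup_le_ker
    (H U : Subgroup G) (hU : IsOpen (U : Set G)) (χ : H →* Circle)
    (hker : ∀ h : H, (h : G) ∈ U → χ h = 1) :
    ∃ χ' : G →* Circle, Continuous χ' ∧ (∀ h : H, χ' h = χ h) ∧ ∀ u ∈ U, χ' u = 1 := by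
  -- the composite `H → G → G/U`
  let φ : H →* G ⧸ U := (QuotientGroup.mk' U).comp H.subtype
  have hφker : φ.ker ≤ χ.ker := by
    intro h hh
    rw [MonoidHom.mem_ker] at hh ⊢
    apply hker
    simpa [φ, QuotientGroup.eq_one_iff] using hh
  -- `χ` descends to `H / ker φ`
  let χbar : H ⧸ φ.ker →* Circle := QuotientGroup.lift φ.ker χ hφker
  -- the injection `H / ker φ ↪ G / U`
  have hinj : Function.Injective (MonoidHom.toAdditive (QuotientGroup.kerLift φ)) := by
    intro a b hab
    apply Additive.toMul.injective
    exact QuotientGroup.kerLift_injective φ (Additive.ofMul.injective hab)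
  obtain ⟨ψ, hψ⟩ := (Module.Baer.of_divisible (Additive Circle)).extension_property_addMonoidHom
    (MonoidHom.toAdditive (QuotientGroup.kerLift φ)) hinj (MonoidHom.toAdditive χbar)
  let χ' : G →* Circle := (MonoidHom.toAdditive.symm ψ).comp (QuotientGroup.mk' U)
  have hU' : ∀ u ∈ U, χ' u = 1 := by
    intro u hu
    have h0 : (QuotientGroup.mk u : G ⧸ U) = 1 := (QuotientGroup.eq_one_iff u).mpr hu
    show Additive.toMul (ψ (Additive.ofMul ((QuotientGroup.mk' U) u))) = 1
    rw [QuotientGroup.mk'_apply, h0]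
    simp
  refine ⟨χ', continuous_of_eq_one_on_open_subgroup χ' U hU hU', fun h => ?_, hU'⟩
  have key := DFunLike.congr_fun hψ (Additive.ofMul (QuotientGroup.mk (s := φ.ker) h))
  simp only [AddMonoidHom.coe_comp, Function.comp_apply, MonoidHom.toAdditive_apply_apply,
    toMul_ofMul, QuotientGroup.kerLift_mk] at key
  have hφh : φ h = (QuotientGroup.mk' U) (h : G) := rfl
  rw [hφh] at key
  have hχbar : χbar (QuotientGroup.mk (s := φ.ker) h) = χ h := rfl
  rw [hχbar] at key
  show Additive.toMul (ψ (Additive.ofMul ((QuotientGroup.mk' U) (h : G)))) = χ h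
  rw [key]
  rfl

/-! ### 5. The main statements -/

/-- **(A8b), basis form.** If the open subgroups of the abelian topological group `G` form a
neighbourhood basis of `1`, every continuous character `χ : H →* Circle` of ANY subgroup `H ≤ G`
extends to a continuous character of `G`. -/
theorem exists_continuous_extension_circle_of_basis
    (hbasis : ∀ W : Set G, IsOpen W → (1 : G) ∈ W →
      ∃ U : Subgroup G, IsOpen (U : Set G) ∧ (U : Set G) ⊆ W)
    (H : Subgroup G) (χ : H →* Circle) (hχ : Continuous χ) :
    ∃ χ' : G →* Circle, Continuous χ' ∧ ∀ h : H, χ' h = χ h := by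
  obtain ⟨U, hU, hker⟩ := exists_open_subgroup_le_ker hbasis H χ hχ
  obtain ⟨χ', hc, hext, -⟩ := exists_continuous_extension_of_open_subgroup_le_ker H U hU χ hker
  exact ⟨χ', hc, hext⟩

/-- **(A8b), profinite form.** For `G` a compact totally disconnected abelian topological group
(e.g. the unit group of the ring of integers of a local field, or the norm-one group of an
unramified or ramified quadratic extension) and ANY subgroup `H ≤ G` (closed or not), every
continuous unitary character `χ : H →* Circle` extends to a continuous unitary character of `G`. -/
theorem exists_continuous_extension_circle_of_profinite [CompactSpace G]
    [TotallyDisconnectedSpace G] (H : Subgroup G) (χ : H →* Circle) (hχ : Continuous χ) :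
    ∃ χ' : G →* Circle, Continuous χ' ∧ ∀ h : H, χ' h = χ h :=
  exists_continuous_extension_circle_of_basis basis_of_profinite H χ hχ

/-- The extension can moreover be chosen trivial on an open subgroup (so it factors through a
finite quotient when `G` is compact): the form used for conductor bookkeeping. -/
theorem exists_continuous_extension_circle_of_profinite' [CompactSpace G]
    [TotallyDisconnectedSpace G] (H : Subgroup G) (χ : H →* Circle) (hχ : Continuous χ) :
    ∃ χ' : G →* Circle, Continuous χ' ∧ (∀ h : H, χ' h = χ h) ∧
      ∃ U : Subgroup G, IsOpen (U : Set G) ∧ ∀ u ∈ U, χ' u = 1 := by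
  obtain ⟨U, hU, hker⟩ := exists_open_subgroup_le_ker basis_of_profinite H χ hχ
  obtain ⟨χ', hc, hext, hU'⟩ :=
    exists_continuous_extension_of_open_subgroup_le_ker H U hU χ hker
  exact ⟨χ', hc, hext, U, hU, hU'⟩

end Summit.Ventures.HodgeRepro2.T5ProfiniteCharacterExtension
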